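import Summits.PneNP.PneNP.Theorems.ExpanderLinearGeneratorsResKSwitching
import HarnessLib

/-!
# The `Res(k)` rung for expanding linear systems, X: parameters and asymptotics

Support file for `stmt-PneNP-11443`. Bookkeeping for the final assembly (file XI):

* `hgt_le`: the heights of the switching lemma satisfy `hgt M i T ≤ B i · M^{tri i} · T`
  (`tri i = i(i+1)/2`, `B` an explicit integer sequence), for `M, T ≥ 1`;
* `eventually_params`: for `c > 0`, `0 < δ`, `γ = 1 - δ (1 + tri k) > 0` and `ε = γ/2`, all the
  numerical side conditions of the assembly hold for every large `n` (with `r = n^{1-δ}`):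
  `4 ≤ r`, `6 ≤ c r`, `c ≤ 32 n^δ`, `2 ≤ n^ε`, and
  `3 · B k · (64 n^δ / c)^{tri k} · (n^ε + 2) < c r / 8`;
* the two halves of the final union bound: the abort probability
  (`exp_mul_inv_two_pow_le_half`: `exp(c r/32) / 2^{⌊c r/4⌋ + 1} ≤ 1/2` once `c r ≥ 6`) and the
  lines' failure probability (`size_mul_inv_two_pow_lt_half`: `S / 2^{⌊n^ε⌋ + 2} < 1/2` when
  `S < 2^{n^ε}`), and the bound `M ≤ 64 n^δ / c` for `M = ⌈32 n / (c r)⌉`.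

[folklore; Segerlind–Buss–Impagliazzo 2004, §3 (parameters of the switching lemma)]
-/

namespace Summit.PneNP.PneNP.Theorems.ResKRestriction

open Finset Filter Topology Literature.Computability.Complexity Literature.Computability.MetaComplexity

/-! ### The closed-form height bound -/

/-- Triangular numbers `tri i = i (i+1) / 2`, by recursion. [folklore] -/
def tri : ℕ → ℕ
  | 0 => 0
  | i + 1 => tri i + (i + 1)

/-- `tri k = (k² + k) / 2`, as real numbers. [folklore] -/
theorem cast_tri (k : ℕ) : ((tri k : ℕ) : ℝ) = ((k : ℝ) ^ 2 + k) / 2 := by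
  induction k with
  | zero => simp [tri]
  | succ i ih => simp only [tri]; push_cast; rw [ih]; ring

/-- The constants of the height bound. [folklore] -/
def Bconst : ℕ → ℕ
  | 0 => 0
  | i + 1 => ((i + 1) + Bconst i * (i + 3)) * 2 ^ (i + 2)

/-- **Closed-form bound for the heights**: `hgt M i T ≤ B i · M^{tri i} · T` for `M, T ≥ 1`.
[Segerlind–Buss–Impagliazzo 2004, §3] [folklore] -/
theorem hgt_le {M : ℕ} (hM : 1 ≤ M) : ∀ (i T : ℕ), 1 ≤ T →
    (hgt M i T : ℝ) ≤ (Bconst i : ℝ) * (M : ℝ) ^ tri i * T := by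
  intro i
  induction i with
  | zero => intro T _; simp [hgt, Bconst]
  | succ i ih =>
    intro T hT
    have hM' : (1 : ℝ) ≤ M := by exact_mod_cast hM
    have hT' : (1 : ℝ) ≤ T := by exact_mod_cast hT
    set s := sPar M (i + 1) T with hs
    have hsR : (s : ℝ) = 2 ^ (i + 2) * (M : ℝ) ^ (i + 1) * T := by
      rw [hs, sPar]; push_cast; ring
    have hs4 : 4 * (T : ℝ) ≤ s := by
      rw [hsR]
      have h1 : (4 : ℝ) ≤ 2 ^ (i + 2) := by
        calc (4 : ℝ) = 2 ^ 2 := by norm_num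
          _ ≤ 2 ^ (i + 2) := pow_le_pow_right₀ (by norm_num) (by omega)
      have h2 : (1 : ℝ) ≤ (M : ℝ) ^ (i + 1) := one_le_pow₀ hM'
      have hT0 : (0 : ℝ) ≤ T := by positivity
      nlinarith [mul_le_mul h1 h2 (by norm_num) (by positivity)]
    set T' := T + (i + 1) * s + 1 with hT'def
    have hT'1 : 1 ≤ T' := by omega
    have hIH := ih T' hT'1
    have hT'le : (T' : ℝ) ≤ (i + 3) * s := by
      rw [hT'def]; push_cast; nlinarith
    have hpow : (M : ℝ) ^ tri (i + 1) = (M : ℝ) ^ tri i * (M : ℝ) ^ (i + 1) := by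
      simp only [tri]; rw [pow_add]
    have hMtri : (1 : ℝ) ≤ (M : ℝ) ^ tri i := one_le_pow₀ hM'
    have hB0 : (0 : ℝ) ≤ Bconst i := Nat.cast_nonneg _
    have hs0 : (0 : ℝ) ≤ s := Nat.cast_nonneg _
    calc (hgt M (i + 1) T : ℝ) = (i + 1) * s + hgt M i T' := by
          simp only [hgt, ← hs, ← hT'def]; push_cast; ring
      _ ≤ (i + 1) * s + Bconst i * (M : ℝ) ^ tri i * T' := by linarith
      _ ≤ (i + 1) * s + Bconst i * (M : ℝ) ^ tri i * ((i + 3) * s) := by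
          gcongr
      _ ≤ ((i + 1) + Bconst i * (i + 3)) * (M : ℝ) ^ tri i * s := by
          have : (i + 1) * (s : ℝ) ≤ (i + 1) * ((M : ℝ) ^ tri i * s) := by
            apply mul_le_mul_of_nonneg_left _ (by positivity)
            nlinarith
          nlinarith
      _ = (Bconst (i + 1) : ℝ) * (M : ℝ) ^ tri (i + 1) * T := by
          rw [hpow, hsR]; simp only [Bconst]; push_cast; ring

/-! ### Eventual inequalities -/

/-- Powers of a cast natural: `(n^δ)^a = n^{δ a}`. [folklore] -/
theorem rpow_natCast_pow (n : ℕ) (δ : ℝ) (a : ℕ) : ((n : ℝ) ^ δ) ^ a = (n : ℝ) ^ (δ * a) := by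
  rw [← Real.rpow_natCast, ← Real.rpow_mul (Nat.cast_nonneg n)]

/-- **The eventual side conditions of the assembly.** [folklore] -/
theorem eventually_params {c δ : ℝ} (hc : 0 < c) (hδ : 0 < δ) (k : ℕ)
    (hγ : 0 < 1 - δ * (1 + tri k)) :
    ∀ᶠ n : ℕ in atTop,
      4 ≤ (n : ℝ) ^ (1 - δ) ∧ 6 ≤ c * (n : ℝ) ^ (1 - δ) ∧ c ≤ 32 * (n : ℝ) ^ δ ∧
      2 ≤ (n : ℝ) ^ ((1 - δ * (1 + tri k)) / 2) ∧
      3 * (Bconst k : ℝ) * (64 / c * (n : ℝ) ^ δ) ^ tri k *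
          ((n : ℝ) ^ ((1 - δ * (1 + tri k)) / 2) + 2) < c * (n : ℝ) ^ (1 - δ) / 8 := by
  set γ := 1 - δ * (1 + tri k) with hγdef
  set ε := γ / 2 with hεdef
  have hε : 0 < ε := by positivity
  have h1δ : 0 < 1 - δ := by
    have : δ * (1 + tri k) ≥ δ := by nlinarith [show (0 : ℝ) ≤ tri k from Nat.cast_nonneg _]
    linarith
  -- the exponents
  set e₁ := δ * tri k + ε with he₁
  have hsplit : 1 - δ = e₁ + γ / 2 := by rw [he₁, hεdef, hγdef]; ring
  have hT1 : Tendsto (fun n : ℕ => (n : ℝ) ^ (1 - δ)) atTop atTop :=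
    (tendsto_rpow_atTop h1δ).comp tendsto_natCast_atTop_atTop
  have hTδ : Tendsto (fun n : ℕ => (n : ℝ) ^ δ) atTop atTop :=
    (tendsto_rpow_atTop hδ).comp tendsto_natCast_atTop_atTop
  have hTε : Tendsto (fun n : ℕ => (n : ℝ) ^ ε) atTop atTop :=
    (tendsto_rpow_atTop hε).comp tendsto_natCast_atTop_atTop
  have hTγ : Tendsto (fun n : ℕ => (n : ℝ) ^ (γ / 2)) atTop atTop :=
    (tendsto_rpow_atTop (by positivity)).comp tendsto_natCast_atTop_atTop
  set C₁ : ℝ := 6 * Bconst k * (64 / c) ^ tri k with hC₁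
  have hC₁0 : 0 ≤ C₁ := by positivity
  filter_upwards [hT1.eventually_ge_atTop (max 4 (6 / c)), hTδ.eventually_ge_atTop (c / 32),
    hTε.eventually_ge_atTop 2, hTγ.eventually_gt_atTop (8 * C₁ / c), eventually_ge_atTop 1]
    with n h1 h2 h3 h4 h5
  have hn0 : (0 : ℝ) ≤ n := Nat.cast_nonneg n
  have hr4 : 4 ≤ (n : ℝ) ^ (1 - δ) := le_trans (le_max_left _ _) h1
  have hr6 : 6 ≤ c * (n : ℝ) ^ (1 - δ) := by
    have : 6 / c ≤ (n : ℝ) ^ (1 - δ) := le_trans (le_max_right _ _) h1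
    rwa [div_le_iff₀ hc, mul_comm] at this
  refine ⟨hr4, hr6, by linarith, h3, ?_⟩
  -- the main inequality: `LHS ≤ C₁ n^{e₁}` and `C₁ n^{e₁} < (c/8) n^{e₁} n^{γ/2}`
  have hpowδ : (64 / c * (n : ℝ) ^ δ) ^ tri k = (64 / c) ^ tri k * (n : ℝ) ^ (δ * tri k) := by
    rw [mul_pow, rpow_natCast_pow]
  have hne : 0 < (n : ℝ) ^ e₁ := Real.rpow_pos_of_pos (by
    have : (1 : ℝ) ≤ n := by exact_mod_cast h5
    linarith) _
  have hLHS : 3 * (Bconst k : ℝ) * (64 / c * (n : ℝ) ^ δ) ^ tri k * ((n : ℝ) ^ ε + 2) ≤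
      C₁ * (n : ℝ) ^ e₁ := by
    rw [hpowδ]
    have h6 : (n : ℝ) ^ ε + 2 ≤ 2 * (n : ℝ) ^ ε := by linarith
    have h7 : (n : ℝ) ^ (δ * tri k) * (n : ℝ) ^ ε = (n : ℝ) ^ e₁ := by
      rw [he₁, Real.rpow_add_of_nonneg hn0 (by positivity) hε.le]
    have h8 : (0 : ℝ) ≤ 3 * (Bconst k : ℝ) * ((64 / c) ^ tri k * (n : ℝ) ^ (δ * tri k)) := by positivity
    calc 3 * (Bconst k : ℝ) * ((64 / c) ^ tri k * (n : ℝ) ^ (δ * tri k)) * ((n : ℝ) ^ ε + 2)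
        ≤ 3 * (Bconst k : ℝ) * ((64 / c) ^ tri k * (n : ℝ) ^ (δ * tri k)) * (2 * (n : ℝ) ^ ε) :=
          mul_le_mul_of_nonneg_left h6 h8
      _ = C₁ * ((n : ℝ) ^ (δ * tri k) * (n : ℝ) ^ ε) := by rw [hC₁]; ring
      _ = C₁ * (n : ℝ) ^ e₁ := by rw [h7]
  have hRHS : c * (n : ℝ) ^ (1 - δ) / 8 = (c / 8) * (n : ℝ) ^ (γ / 2) * (n : ℝ) ^ e₁ := by
    rw [hsplit, Real.rpow_add_of_nonneg hn0 (by positivity) (by positivity)]; ring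
  rw [hRHS]
  refine lt_of_le_of_lt hLHS ?_
  refine mul_lt_mul_of_pos_right ?_ hne
  rw [div_lt_iff₀ hc] at h4
  linarith

/-! ### The numerical halves of the union bound -/

/-- **The abort half**: `exp(c r / 32) / 2^{⌊c r / 4⌋ + 1} ≤ 1/2` once `c r ≥ 6`. [folklore] -/
theorem exp_mul_inv_two_pow_le_half {x : ℝ} (hx : 6 ≤ x) :
    Real.exp (x / 32) * ((2 : ℝ) ^ (⌊x / 4⌋₊ + 1))⁻¹ ≤ 1 / 2 := by
  have hlog := Real.log_two_gt_d9
  have h2pow : Real.exp (x / 4 * Real.log 2) ≤ (2 : ℝ) ^ (⌊x / 4⌋₊ + 1) := by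
    have hfl : x / 4 ≤ (⌊x / 4⌋₊ + 1 : ℕ) := by
      push_cast; exact (Nat.lt_floor_add_one (x / 4)).le
    calc Real.exp (x / 4 * Real.log 2) ≤ Real.exp ((⌊x / 4⌋₊ + 1 : ℕ) * Real.log 2) := by
          apply Real.exp_le_exp.2
          exact mul_le_mul_of_nonneg_right hfl (by linarith)
      _ = (2 : ℝ) ^ (⌊x / 4⌋₊ + 1) := by
          rw [← Real.rpow_natCast, Real.rpow_def_of_pos (by norm_num), mul_comm]
  have hkey : Real.exp (x / 32) * 2 ≤ Real.exp (x / 4 * Real.log 2) := by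
    have : Real.exp (x / 32) * 2 = Real.exp (x / 32 + Real.log 2) := by
      rw [Real.exp_add, Real.exp_log (by norm_num)]
    rw [this]
    apply Real.exp_le_exp.2
    nlinarith
  have hpos : (0 : ℝ) < (2 : ℝ) ^ (⌊x / 4⌋₊ + 1) := by positivity
  rw [mul_inv_le_iff₀ hpos]
  linarith

/-- **The lines' half**: if `S < 2^{n^ε}` then `S / 2^{⌊n^ε⌋ + 2} < 1/2`. [folklore] -/
theorem size_mul_inv_two_pow_lt_half {S : ℕ} {z : ℝ} (hS : (S : ℝ) < (2 : ℝ) ^ z) :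
    (S : ℝ) * ((2 : ℝ) ^ (⌊z⌋₊ + 2))⁻¹ < 1 / 2 := by
  have hfl : z ≤ (⌊z⌋₊ + 1 : ℕ) := by push_cast; exact (Nat.lt_floor_add_one z).le
  have h1 : (2 : ℝ) ^ z ≤ (2 : ℝ) ^ (⌊z⌋₊ + 1) := by
    calc (2 : ℝ) ^ z ≤ (2 : ℝ) ^ ((⌊z⌋₊ + 1 : ℕ) : ℝ) :=
          Real.rpow_le_rpow_of_exponent_le (by norm_num) hfl
      _ = (2 : ℝ) ^ (⌊z⌋₊ + 1) := Real.rpow_natCast _ _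
  have hpos : (0 : ℝ) < (2 : ℝ) ^ (⌊z⌋₊ + 2) := by positivity
  rw [mul_inv_lt_iff₀ hpos]
  have : (2 : ℝ) ^ (⌊z⌋₊ + 2) = 2 * (2 : ℝ) ^ (⌊z⌋₊ + 1) := by ring
  rw [this]
  linarith

/-- **The size of `M`**: for `M = ⌈32 n / (c r)⌉` with `c r ≤ 32 n` (and `c, r > 0`):
`1 ≤ M`, `n / M ≤ c r / 32` and `M ≤ 64 n / (c r)`. [folklore] -/
theorem ceil_params {n : ℕ} {c r : ℝ} (hc : 0 < c) (hr : 0 < r) (hn : 0 < n)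
    (hcr : c * r ≤ 32 * n) :
    1 ≤ ⌈32 * (n : ℝ) / (c * r)⌉₊ ∧
      (n : ℝ) / ⌈32 * (n : ℝ) / (c * r)⌉₊ ≤ c * r / 32 ∧
      (⌈32 * (n : ℝ) / (c * r)⌉₊ : ℝ) ≤ 64 * n / (c * r) := by
  have hcr0 : 0 < c * r := mul_pos hc hr
  have hn0 : (0 : ℝ) < n := by exact_mod_cast hn
  have hq : 1 ≤ 32 * (n : ℝ) / (c * r) := by rw [le_div_iff₀ hcr0]; linarith
  have hceil : 32 * (n : ℝ) / (c * r) ≤ ⌈32 * (n : ℝ) / (c * r)⌉₊ := Nat.le_ceil _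
  have hM1 : 1 ≤ ⌈32 * (n : ℝ) / (c * r)⌉₊ := Nat.one_le_ceil_iff.2 (by linarith)
  refine ⟨hM1, ?_, ?_⟩
  · have hMpos : (0 : ℝ) < ⌈32 * (n : ℝ) / (c * r)⌉₊ := by exact_mod_cast hM1
    rw [div_le_iff₀ hMpos]
    calc (n : ℝ) = c * r / 32 * (32 * n / (c * r)) := by field_simp
      _ ≤ c * r / 32 * ⌈32 * (n : ℝ) / (c * r)⌉₊ := by gcongr
  · calc (⌈32 * (n : ℝ) / (c * r)⌉₊ : ℝ) ≤ 32 * (n : ℝ) / (c * r) + 1 := (Nat.ceil_lt_add_one (by positivity)).le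
      _ ≤ 32 * n / (c * r) + 32 * n / (c * r) := by linarith
      _ = 64 * n / (c * r) := by ring

end Summit.PneNP.PneNP.Theorems.ResKRestriction
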